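import Mathlib
import Summits.NavierStokesRegularity.FluidComputer.TransportGalerkinLevelSubspace
import Summits.NavierStokesRegularity.FluidComputer.TransportSobolevEnergyZero
import Summits.NavierStokesRegularity.FluidComputer.TransportGalerkinEnergyLevel
import Summits.NavierStokesRegularity.FluidComputer.TransportGalerkinResidencePrep
import Literature.Analysis.ODE.GlobalExistence
import HarnessLib

/-!
# Galerkin limit of the transport model, XV-b: the Galerkin levels EXIST globally and keep the linear clauses (instab g19, cell `ns-blowup`, 2026-08-27)

HONEST FRAMING (human ruling D-0035): nothing here is a claim about Navier–Stokes blow-up.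
WHAT THIS IS NOT: not NS — the finite-dimensional Galerkin ODE of the MODEL (host-perturbation
equation on `𝕋³` in the scaled phase space `E = lp (ℤ³ → ℂ³) 2`): a closed invariant subspace, a
locally Lipschitz field, an `L²` energy bound, and the tree's continuation principle. No certificate
is touched and no census word moves.

PURPOSE. After parts IV–XIV, the KEEP word for the model
(`TransportGalerkinEmergenceLevels.half_prediction_nsField_of_levels`,
`TransportGalerkinAbcH2.exists_keep_eigenvector_abc_of_levels`) takes the Galerkin levels `u n` of the
seed as INPUTS: `C¹` solutions of `y' = P_N F(y)` on `[0, T]` in `range P_N` keeping the three linear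
clauses. This file CONSTRUCTS them (`exists_level_solution`) for `V = ℂ³`, `π = proj`,
`P = lerayCLM` and any rapidly decreasing, real, divergence-free host with `ν ≥ 0`:

* (part XV-a, `TransportGalerkinLevelSubspace`) `levelSubspace N`, `levelField N`: the closed
  constrained level and the locally Lipschitz truncated field on it;
* §3 the a-priori bound: along every solution `‖Λ⁻² ⇑y‖₀²` grows at most like `e^{2H₀ t}`
  (part VIII's `two_re_pairing_field_le_zero` + the level weight of part VIII + Gronwall), hence
  `‖y t‖ ≤ R(T)` on `[0, T]`;
* §4 `exists_level_solution` — global existence by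
  `Literature.Analysis.ODE.exists_solution_of_apriori_bound`, returned in `E` with exactly the fields
  the KEEP theorem consumes (`sol_continuousOn`, `sol_init`, `sol_hasDerivWithinAt`, `sol_derivCont`,
  `sol_proj`, `sol_fix`, `sol_real`, `sol_div`).

KERNEL STATE: with this file the residence input (β3) of the R-β chain is discharged COMPLETELY for
the model of record — certificates + X0 row ⇒ KEEP, the only remaining hypotheses being the
regularity class in which the true solution `w` is read.
-/

noncomputable section

open scoped ENNReal NNReal ComplexConjugate InnerProductSpace
open Set Filter Topology

namespace Summit.NavierStokesRegularity.FluidComputer.TransportGalerkinLevelExistence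

open RCLike
open Literature.Analysis.FunctionSpaces Literature.Analysis.FunctionSpaces.Lattice
open Literature.Analysis.FunctionSpaces.Torus Literature.Analysis.FunctionSpaces.EuclideanSpace
open Literature.Analysis.ODE Literature.Analysis.FluidPDE
open Summit.NavierStokesRegularity.FluidComputer.GalerkinLatticePhaseSpace
open Summit.NavierStokesRegularity.FluidComputer.TransportGalerkin
open Summit.NavierStokesRegularity.FluidComputer.TransportGalerkinRapid
open Summit.NavierStokesRegularity.FluidComputer.TransportGalerkinBox
open Summit.NavierStokesRegularity.FluidComputer.TransportGalerkinEigen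
open Summit.NavierStokesRegularity.FluidComputer.TransportGalerkinContinuity
open Summit.NavierStokesRegularity.FluidComputer.TransportGalerkinInvariance
open Summit.NavierStokesRegularity.FluidComputer.TransportGalerkinAbc
open Summit.NavierStokesRegularity.FluidComputer.TransportGalerkinEnergyLevel
open Summit.NavierStokesRegularity.FluidComputer.TransportGalerkinResidencePrep
open Summit.NavierStokesRegularity.FluidComputer.TransportSobolevEnergyZero
open Summit.NavierStokesRegularity.FluidComputer.LatticeBoxInterpolation
open Summit.NavierStokesRegularity.FluidComputer.TransportGalerkinLevelSubspace
open Summit.NavierStokesRegularity.FluidComputer.TransportGalerkinOneSided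

/-! ## §3 The a-priori `L²` bound along every solution -/

section Apriori

variable {ν : ℝ} {Uv : (Fin 3 → ℤ) → EuclideanSpace ℂ (Fin 3)}

/-- A solution of the ODE on the constrained level, seen in `E`. -/
theorem hasDerivWithinAt_coe_levelField (hUv : RapidDecay Uv) (hUreal : IsConjSymm Uv) {N : ℕ}
    {α : ℝ → levelSubspace N} {S : Set ℝ} {t : ℝ}
    (hα : HasDerivWithinAt α (levelField ν hUv hUreal N (α t)) S t) :
    HasDerivWithinAt (fun τ => ((α τ : levelSubspace N) : lp (fun _ : (Fin 3 → ℤ) => EuclideanSpace ℂ (Fin 3)) 2))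
      (cubeProj N (nsField ν Uv (fun j => (EuclideanSpace.proj j : EuclideanSpace ℂ (Fin 3) →L[ℂ] ℂ)) lerayCLM
        ((α t : levelSubspace N) : lp (fun _ : (Fin 3 → ℤ) => EuclideanSpace ℂ (Fin 3)) 2))) S t := by
  have h0 := (levelSubspace N).subtypeL.hasFDerivAt.comp_hasDerivWithinAt t hα
  have h1 : (fun τ => ((α τ : levelSubspace N) : lp (fun _ : (Fin 3 → ℤ) => EuclideanSpace ℂ (Fin 3)) 2)) =
      ⇑(levelSubspace N).subtypeL ∘ α := by
    funext τ; rfl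
  rw [h1]
  refine h0.congr_deriv ?_
  rw [Submodule.subtypeL_apply, coe_levelField]

/-- **The `L²` energy of the unscaled family grows at most exponentially along a solution**
(`E`-valued form): if `u` solves `u' = P_N F(u)` within `[0, s]` and stays in the constrained level,
then `‖Λ⁻² ⇑(u t)‖₀² ≤ ‖Λ⁻² ⇑(u 0)‖₀² · e^{2H₀ t}`, `H₀ = card·2π·A₁(Uv)` (part VIII + Gronwall). -/
theorem energy_zero_le_of_solution (hν : 0 ≤ ν) (hUv : RapidDecay Uv) (hUreal : IsConjSymm Uv)
    (hUdiv : ∑ j, freqDeriv j (fun p => (EuclideanSpace.proj j : EuclideanSpace ℂ (Fin 3) →L[ℂ] ℂ) (Uv p)) = 0)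
    {N : ℕ} {s : ℝ} {u : ℝ → lp (fun _ : (Fin 3 → ℤ) => EuclideanSpace ℂ (Fin 3)) 2}
    (hu' : ∀ t ∈ Icc 0 s, HasDerivWithinAt u
      (cubeProj N (nsField ν Uv (fun j => (EuclideanSpace.proj j : EuclideanSpace ℂ (Fin 3) →L[ℂ] ℂ)) lerayCLM (u t)))
      (Icc 0 s) t)
    (hmem : ∀ t, u t ∈ levelSubspace N) :
    ∀ t ∈ Icc 0 s, (eNormSq (-2) (⇑(u t))).toReal ≤ (eNormSq (-2) (⇑(u 0))).toReal *
        Real.exp ((2 * (((Fintype.card (Fin 3) : ℝ) * (2 * Real.pi)) *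
          (∑' l, ENNReal.ofReal (sobolevWeight 1 l) * ‖Uv l‖ₑ).toReal)) * t) := by
  set H₀ : ℝ := ((Fintype.card (Fin 3) : ℝ) * (2 * Real.pi)) *
    (∑' l, ENNReal.ofReal (sobolevWeight 1 l) * ‖Uv l‖ₑ).toReal with hH₀
  have hUreal' := (isConjSymm_iff_proj Uv).1 hUreal
  have hproj : ∀ t, cubeProj N (u t) = u t := fun t => (hmem t).1
  -- the weight of order 0 (symbol `⟨k⟩^{2(0-2)}` on the cube)
  obtain ⟨D, hD⟩ := exists_levelWeight (d := Fin 3) (V := EuclideanSpace ℂ (Fin 3)) ((0 : ℝ) - 2) N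
  have hfS : ∀ t, re ⟪D (u t), u t⟫_ℂ = (eNormSq (-2) (⇑(u t))).toReal := by
    intro t
    rw [re_inner_levelWeight_self hD (hproj t), show (0 : ℝ) - 2 = -2 by norm_num]
  have hfc : ContinuousOn (fun τ => re ⟪D (u τ), u τ⟫_ℂ) (Icc 0 s) := by
    have hc : ContinuousOn u (Icc 0 s) := fun t ht => (hu' t ht).continuousWithinAt
    have h1 : ContinuousOn (fun τ => ⟪D (u τ), u τ⟫_ℂ) (Icc 0 s) :=
      (D.continuous.comp_continuousOn hc).inner hc
    exact RCLike.continuous_re.comp_continuousOn h1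
  have hf' : ∀ t ∈ Ico 0 s, HasDerivWithinAt (fun τ => re ⟪D (u τ), u τ⟫_ℂ)
      (2 * re ⟪D (u t), cubeProj N (nsField ν Uv (fun j => (EuclideanSpace.proj j : EuclideanSpace ℂ (Fin 3) →L[ℂ] ℂ))
        lerayCLM (u t))⟫_ℂ) (Ici t) t := by
    intro t ht
    refine hasDerivWithinAt_levelEnergy hD ((hu' t (Ico_subset_Icc_self ht)).mono_of_mem_nhdsWithin ?_)
    exact Set.ordConnected_Icc.mem_nhdsGE (Ico_subset_Icc_self ht) (right_mem_Icc.2 (ht.1.trans ht.2.le)) ht.2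
  have hbound : ∀ t ∈ Ico 0 s, 2 * re ⟪D (u t), cubeProj N (nsField ν Uv
      (fun j => (EuclideanSpace.proj j : EuclideanSpace ℂ (Fin 3) →L[ℂ] ℂ)) lerayCLM (u t))⟫_ℂ ≤
        (2 * H₀) * re ⟪D (u t), u t⟫_ℂ + 0 := by
    intro t ht
    have hx := hproj t
    have hxr : RapidDecay (⇑(u t)) := rapidDecay_of_mem_levelSubspace (hmem t)
    have hxW := mem_box_of_mem_levelSubspace (hmem t) (ρ := fun k => ‖(u t : (Fin 3 → ℤ) → EuclideanSpace ℂ (Fin 3)) k‖)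
      fun k => le_rfl
    have h := two_re_pairing_field_le_zero hν hUv (fun j => (EuclideanSpace.proj j : EuclideanSpace ℂ (Fin 3) →L[ℂ] ℂ))
      TransportGalerkinAbc.norm_proj_le hUreal' hUdiv lerayCLM isSelfAdjoint_lerayCLM (rapidDecay_wmul hxr (-2)) (unscale_fix hxW)
      (comp_unscale_real hxW) (comp_unscale_div hxW)
    rw [re_inner_levelWeight_nsField_eq hUv norm_lerayCLM_le hD hx, wmul_zero, wmul_zero, hfS t, add_zero,
      ← eNormSq_unscale' ]
    exact h
  intro t ht
  have hG := le_gronwallBound_of_hasDerivWithinAt hfc hf' hbound t ht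
  rw [sub_zero, gronwallBound_ε0, hfS 0, hfS t] at hG
  exact hG

/-- **A-priori bound in `E`** along every solution staying in the constrained level, on
`[0, s] ⊆ [0, T]`: `‖u t‖ ≤ R_N · √(‖Λ⁻² ⇑(u 0)‖₀²) · e^{H₀ T}`. -/
theorem norm_le_of_solution (hν : 0 ≤ ν) (hUv : RapidDecay Uv) (hUreal : IsConjSymm Uv)
    (hUdiv : ∑ j, freqDeriv j (fun p => (EuclideanSpace.proj j : EuclideanSpace ℂ (Fin 3) →L[ℂ] ℂ) (Uv p)) = 0)
    {N : ℕ} {s T : ℝ} (hsT : s ≤ T) {u : ℝ → lp (fun _ : (Fin 3 → ℤ) => EuclideanSpace ℂ (Fin 3)) 2}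
    (hu' : ∀ t ∈ Icc 0 s, HasDerivWithinAt u
      (cubeProj N (nsField ν Uv (fun j => (EuclideanSpace.proj j : EuclideanSpace ℂ (Fin 3) →L[ℂ] ℂ)) lerayCLM (u t)))
      (Icc 0 s) t)
    (hmem : ∀ t, u t ∈ levelSubspace N) :
    ∀ t ∈ Icc 0 s, ‖u t‖ ≤
      (∑ k ∈ Fintype.piFinset (fun _ : Fin 3 => Finset.Icc (-(N : ℤ)) N), sobolevWeight (0 - (-2)) k + 1) *
        Real.sqrt (eNormSq (-2) (⇑(u 0))).toReal *
        Real.exp ((((Fintype.card (Fin 3) : ℝ) * (2 * Real.pi)) *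
          (∑' l, ENNReal.ofReal (sobolevWeight 1 l) * ‖Uv l‖ₑ).toReal) * T) := by
  intro t ht
  set R : ℝ := ∑ k ∈ Fintype.piFinset (fun _ : Fin 3 => Finset.Icc (-(N : ℤ)) N), sobolevWeight (0 - (-2)) k + 1 with hR
  have hR0 : 0 ≤ R := add_nonneg (Finset.sum_nonneg fun k _ => (sobolevWeight_pos _ k).le) zero_le_one
  set H₀ : ℝ := ((Fintype.card (Fin 3) : ℝ) * (2 * Real.pi)) *
    (∑' l, ENNReal.ofReal (sobolevWeight 1 l) * ‖Uv l‖ₑ).toReal with hH₀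
  have hH₀0 : 0 ≤ H₀ := by positivity
  set e0 := (eNormSq (-2) (⇑(u 0))).toReal with he0
  have he00 : 0 ≤ e0 := ENNReal.toReal_nonneg
  have henergy := energy_zero_le_of_solution hν hUv hUreal hUdiv hu' hmem t ht
  have h1 := norm_le_of_mem_levelSubspace' (hmem t)
  have h2 : ‖u t‖ ^ 2 ≤ (R * Real.sqrt e0 * Real.exp (H₀ * T)) ^ 2 := by
    have hexp : Real.exp ((2 * H₀) * t) ≤ Real.exp (H₀ * T) ^ 2 := by
      rw [← Real.exp_nat_mul]; push_cast
      exact Real.exp_le_exp.2 (by nlinarith [ht.1, ht.2, hsT, hH₀0])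
    have hsq : Real.sqrt (eNormSq (-2) (⇑(u t))).toReal ^ 2 ≤ e0 * Real.exp ((2 * H₀) * t) := by
      rw [Real.sq_sqrt ENNReal.toReal_nonneg]; exact henergy
    calc ‖u t‖ ^ 2 ≤ (R * Real.sqrt (eNormSq (-2) (⇑(u t))).toReal) ^ 2 :=
          pow_le_pow_left₀ (norm_nonneg _) h1 2
      _ = R ^ 2 * Real.sqrt (eNormSq (-2) (⇑(u t))).toReal ^ 2 := by ring
      _ ≤ R ^ 2 * (e0 * Real.exp ((2 * H₀) * t)) := mul_le_mul_of_nonneg_left hsq (sq_nonneg _)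
      _ ≤ R ^ 2 * (e0 * Real.exp (H₀ * T) ^ 2) := by gcongr
      _ = (R * Real.sqrt e0 * Real.exp (H₀ * T)) ^ 2 := by
          rw [mul_pow, mul_pow, Real.sq_sqrt he00]; ring
  exact (pow_le_pow_iff_left₀ (norm_nonneg _) (by positivity) two_ne_zero).1 h2

end Apriori

/-! ## §4 Global existence of the constrained Galerkin levels -/

section Existence

variable {ν : ℝ} {Uv : (Fin 3 → ℤ) → EuclideanSpace ℂ (Fin 3)}

/-- **The Galerkin levels of the model exist globally and keep the linear clauses**
(`exists_level_solution`). Host: `ν ≥ 0`, `Uv` rapidly decreasing, conjugate-symmetric and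
divergence-free (through `proj`). For every level `N` and every constrained seed `x₀ ∈ S_N` there is
`u : ℝ → E` with `u 0 = x₀`, solving `u' = P_N F(u)` within `[0, T]` for every `T` (right derivative at
`0`), with CONTINUOUS right-hand side, and with `u t ∈ S_N` for all `t` (`P_N`-fixed, Leray-fixed,
real, transversal). Finite-dimensional Picard–Lindelöf + the `L²` energy bound of §3 via the tree's
continuation principle `Literature.Analysis.ODE.exists_solution_of_apriori_bound`. -/
theorem exists_level_solution (hν : 0 ≤ ν) (hUv : RapidDecay Uv) (hUreal : IsConjSymm Uv)
    (hUdiv : ∑ j, freqDeriv j (fun p => (EuclideanSpace.proj j : EuclideanSpace ℂ (Fin 3) →L[ℂ] ℂ) (Uv p)) = 0)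
    (N : ℕ) {x₀ : lp (fun _ : (Fin 3 → ℤ) => EuclideanSpace ℂ (Fin 3)) 2} (hx₀ : x₀ ∈ levelSubspace N) :
    ∃ u : ℝ → lp (fun _ : (Fin 3 → ℤ) => EuclideanSpace ℂ (Fin 3)) 2, u 0 = x₀ ∧
      (∀ T : ℝ, ∀ t ∈ Icc 0 T, HasDerivWithinAt u
        (cubeProj N (nsField ν Uv (fun j => (EuclideanSpace.proj j : EuclideanSpace ℂ (Fin 3) →L[ℂ] ℂ)) lerayCLM (u t)))
        (Icc 0 T) t) ∧
      (∀ T : ℝ, ContinuousOn (fun t => cubeProj N (nsField ν Uv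
        (fun j => (EuclideanSpace.proj j : EuclideanSpace ℂ (Fin 3) →L[ℂ] ℂ)) lerayCLM (u t))) (Icc 0 T)) ∧
      ∀ t, u t ∈ levelSubspace N := by
  haveI : CompleteSpace (levelSubspace N) := (isClosed_levelSubspace N).completeSpace_coe
  -- hypotheses of the continuation principle, for the autonomous field `v t z = levelField z`
  have hlip : ∀ T ρ : ℝ, ∃ K : ℝ≥0, ∀ t ∈ Icc 0 T,
      LipschitzOnWith K ((fun (_ : ℝ) (z : levelSubspace N) => levelField ν hUv hUreal N z) t)
        (Metric.closedBall 0 ρ) := by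
    intro T ρ
    obtain ⟨K, hK⟩ := exists_lipschitzOnWith_levelField (ν := ν) hUv hUreal N ρ
    exact ⟨K, fun t _ => hK⟩
  have hcont : ∀ z : levelSubspace N,
      ContinuousOn (fun t : ℝ => (fun (_ : ℝ) (z : levelSubspace N) => levelField ν hUv hUreal N z) t z) (Ici 0) :=
    fun z => continuousOn_const
  have hH₀0 : 0 ≤ ((Fintype.card (Fin 3) : ℝ) * (2 * Real.pi)) *
      (∑' l, ENNReal.ofReal (sobolevWeight 1 l) * ‖Uv l‖ₑ).toReal := by positivity
  have hRN0 : 0 ≤ ∑ k ∈ Fintype.piFinset (fun _ : Fin 3 => Finset.Icc (-(N : ℤ)) N), sobolevWeight (0 - (-2)) k + 1 :=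
    add_nonneg (Finset.sum_nonneg fun k _ => (sobolevWeight_pos _ k).le) zero_le_one
  have hapriori : ∀ T : ℝ, 0 ≤ T → ∃ R : ℝ, ‖(⟨x₀, hx₀⟩ : levelSubspace N)‖ ≤ R ∧
      ∀ s ∈ Icc 0 T, ∀ α : ℝ → levelSubspace N, α 0 = ⟨x₀, hx₀⟩ →
      (∀ t ∈ Icc 0 s, HasDerivWithinAt α
        ((fun (_ : ℝ) (z : levelSubspace N) => levelField ν hUv hUreal N z) t (α t)) (Icc 0 s) t) →
      ∀ t ∈ Icc 0 s, ‖α t‖ ≤ R := by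
    intro T hT
    refine ⟨(∑ k ∈ Fintype.piFinset (fun _ : Fin 3 => Finset.Icc (-(N : ℤ)) N), sobolevWeight (0 - (-2)) k + 1) *
        Real.sqrt (eNormSq (-2) (⇑x₀)).toReal *
        Real.exp ((((Fintype.card (Fin 3) : ℝ) * (2 * Real.pi)) *
          (∑' l, ENNReal.ofReal (sobolevWeight 1 l) * ‖Uv l‖ₑ).toReal) * T), ?_, fun s hs α hα0 hα t ht => ?_⟩
    · have h := norm_le_of_mem_levelSubspace' hx₀
      have h1 : 1 ≤ Real.exp ((((Fintype.card (Fin 3) : ℝ) * (2 * Real.pi)) *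
          (∑' l, ENNReal.ofReal (sobolevWeight 1 l) * ‖Uv l‖ₑ).toReal) * T) := Real.one_le_exp (mul_nonneg hH₀0 hT)
      have hn : ‖(⟨x₀, hx₀⟩ : levelSubspace N)‖ = ‖x₀‖ := rfl
      rw [hn]
      exact h.trans (le_mul_of_one_le_right (by positivity) h1)
    · have h := norm_le_of_solution (ν := ν) hν hUv hUreal hUdiv hs.2
        (u := fun τ => ((α τ : levelSubspace N) : lp (fun _ : (Fin 3 → ℤ) => EuclideanSpace ℂ (Fin 3)) 2))
        (fun τ hτ => hasDerivWithinAt_coe_levelField hUv hUreal (hα τ hτ)) (fun τ => (α τ).2) t ht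
      dsimp only at h
      rw [hα0, Submodule.coe_mk] at h
      exact h
  obtain ⟨α, hα0, hα⟩ := exists_solution_of_apriori_bound hlip hcont hapriori
  -- the solution in `E`
  have hcoe : ∀ T, ∀ t ∈ Icc 0 T, HasDerivWithinAt
      (fun τ => ((α τ : levelSubspace N) : lp (fun _ : (Fin 3 → ℤ) => EuclideanSpace ℂ (Fin 3)) 2))
      (cubeProj N (nsField ν Uv (fun j => (EuclideanSpace.proj j : EuclideanSpace ℂ (Fin 3) →L[ℂ] ℂ)) lerayCLM
        ((α t : levelSubspace N) : lp (fun _ : (Fin 3 → ℤ) => EuclideanSpace ℂ (Fin 3)) 2))) (Icc 0 T) t :=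
    fun T t ht => hasDerivWithinAt_coe_levelField hUv hUreal (hα T t ht)
  have hfield_cont : Continuous fun z : levelSubspace N =>
      ((levelField ν hUv hUreal N z : levelSubspace N) : lp (fun _ : (Fin 3 → ℤ) => EuclideanSpace ℂ (Fin 3)) 2) :=
    continuous_subtype_val.comp (continuous_levelField (ν := ν) hUv hUreal N)
  refine ⟨fun t => ((α t : levelSubspace N) : lp (fun _ : (Fin 3 → ℤ) => EuclideanSpace ℂ (Fin 3)) 2),
    by show ((α 0 : levelSubspace N) : lp (fun _ : (Fin 3 → ℤ) => EuclideanSpace ℂ (Fin 3)) 2) = x₀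
       rw [hα0, Submodule.coe_mk], hcoe, fun T => ?_, fun t => (α t).2⟩
  have hαc : ContinuousOn α (Icc 0 T) := fun t ht => (hα T t ht).continuousWithinAt
  have heq : (fun t => cubeProj N (nsField ν Uv (fun j => (EuclideanSpace.proj j : EuclideanSpace ℂ (Fin 3) →L[ℂ] ℂ))
      lerayCLM ((α t : levelSubspace N) : lp (fun _ : (Fin 3 → ℤ) => EuclideanSpace ℂ (Fin 3)) 2))) =
      fun t => ((levelField ν hUv hUreal N (α t) : levelSubspace N) : lp (fun _ : (Fin 3 → ℤ) => EuclideanSpace ℂ (Fin 3)) 2) := by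
    funext t; exact (coe_levelField hUv hUreal (α t)).symm
  rw [heq]
  exact hfield_cont.comp_continuousOn hαc

end Existence

end Summit.NavierStokesRegularity.FluidComputer.TransportGalerkinLevelExistence

end
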